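import Mathlib
import Summits.ResolutionOfSingularities.ResolutionOfSingularities.Theorems.WildQuotientsWildQuotientResolutionJordanFourConeVertexIdeals

/-!
# V4U cone bricks, cone side (3): the vertex ideal is the contraction of `(x_a, x_b, x_c)`

(crux stmt-ResolutionOfSingularities-15640 `WildQuotients.WildQuotientResolution`, line `Sketch`,
sector `|G| = p`; programme V4U of `L/w45c/CHAIN.md` v7.3 §4 row stub-4 «presentation-side
identifications» for the CONE BRICKS `HP₀`/`HP₁` (RULING v7.1: «centre identification
Z = cone vertex × 𝔸»), cone side. [OURS · L1 W4.5c] — NOT a statement of any manuscript; replaces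
the role of no printed item. Prover res-L1-w45c-stub-4.)

The centre of the exit blow-up is given UPSTAIRS as (the image of) the fixed curve, cut out in the
slot coordinates by `x_a = x_b = x_c = 0`; DOWNSTAIRS it must be the vertex ideal `𝔪` of the cone
ring. The cone-side half of that identification, for both V4U cones:

* `Third112.comap_presentation_span_X` / `Half111.comap_presentation_span_X` — in `k[Y]`,
  `presentation⁻¹ (x_a, x_b, x_c) = (the generator symbols)`: a symbol polynomial whose image lies in
  `(x_a, x_b, x_c)` is, modulo the generator symbols, a passenger polynomial (generic
  `ConeVertex.sub_rename_killCompl_mem_span`, p503613), whose image is the same passenger polynomial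
  in `k[x]`, and a passenger polynomial in `(x_a, x_b, x_c)` is zero
  (`ConeVertex.eq_zero_of_rename_mem_span_X_image`). In particular `ker presentation ≤ (symbols)`.
* `Third112.comap_lift_span_X` / `Half111.comap_lift_span_X` — the same for the presented ring
  `A = k[Y] ⧸ ker`: the contraction of `(x_a, x_b, x_c)` along the injection `A → k[x]` is EXACTLY the
  vertex ideal `𝔪 = (generator classes)` (not only up to radical).
-/

-- single-problem summit: the doubled namespace component `ResolutionOfSingularities` is forced
set_option linter.dupNamespace false

noncomputable section

open MvPolynomial

namespace Summit.ResolutionOfSingularities.ResolutionOfSingularities.Theorems.WildQuotientResolution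

/-! ## Generic: a polynomial in variables off `s` lying in `(X i : i ∈ s)` is zero -/

namespace ConeVertex

/-- If `f : σ → τ` is injective with range disjoint from `s ⊆ τ`, a polynomial `rename f q` in the
variables `range f` that lies in the ideal `(X i : i ∈ s)` is zero. [folklore] -/
theorem eq_zero_of_rename_mem_span_X_image {σ τ R : Type*} [CommRing R] {f : σ → τ}
    (hf : Function.Injective f) (s : Set τ) (hs : ∀ i ∈ s, i ∉ Set.range f) (q : MvPolynomial σ R)
    (hq : rename f q ∈ Ideal.span (X '' s : Set (MvPolynomial τ R))) : q = 0 := by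
  classical
  rw [MvPolynomial.mem_ideal_span_X_image, support_rename_of_injective hf] at hq
  by_contra hne
  obtain ⟨m, hm⟩ := Finset.nonempty_iff_ne_empty.mpr (mt MvPolynomial.support_eq_empty.mp hne)
  obtain ⟨i, his, hi⟩ := hq (Finsupp.mapDomain f m) (Finset.mem_image_of_mem _ hm)
  exact hi (Finsupp.mapDomain_notin_range _ _ (hs i his))

/-- **Contraction of a variable ideal through a presentation factoring the passenger projection.**
Let `π : k[Y] → k[x]` be an algebra map, `f : σ ↪ Y` the passenger symbols with `π (Y_{f i}) = x_{v i}`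
for an injection `v : σ → vars`, and `s` a set of variables off `range v` such that every symbol off
`range f` maps into `(x_i : i ∈ s)`. Then `π⁻¹ (x_i : i ∈ s) = (Y_j : j ∉ range f)`. [folklore] -/
theorem comap_span_X_image_eq {σ Y V k : Type*} [Field k] {f : σ → Y} (hf : Function.Injective f)
    (π : MvPolynomial Y k →ₐ[k] MvPolynomial V k) (v : σ → V) (hv : Function.Injective v)
    (hπf : ∀ i, π (X (f i)) = X (v i)) (s : Set V) (hs : ∀ i ∈ s, i ∉ Set.range v)
    (hπs : ∀ j, j ∉ Set.range f → π (X j) ∈ Ideal.span (X '' s : Set (MvPolynomial V k))) :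
    Ideal.comap π (Ideal.span (X '' s : Set (MvPolynomial V k))) =
      Ideal.span (X '' (Set.range f)ᶜ : Set (MvPolynomial Y k)) := by
  classical
  have hle : Ideal.span (X '' (Set.range f)ᶜ : Set (MvPolynomial Y k)) ≤
      Ideal.comap π (Ideal.span (X '' s : Set (MvPolynomial V k))) := by
    rw [Ideal.span_le]
    rintro _ ⟨j, hj, rfl⟩
    exact hπs j hj
  refine le_antisymm (fun F hF => ?_) hle
  rw [Ideal.mem_comap] at hF
  have h1 := sub_rename_killCompl_mem_span hf F
  set q := killCompl hf F with hq
  -- `π (rename f q) = rename v q`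
  have hcomp : π.comp (rename f) = rename v := by
    apply MvPolynomial.algHom_ext
    intro i
    rw [AlgHom.comp_apply, rename_X, rename_X, hπf]
  have h2 : π (rename f q) = rename v q := by
    rw [← AlgHom.comp_apply, hcomp]
  have h3 : rename v q ∈ Ideal.span (X '' s : Set (MvPolynomial V k)) := by
    rw [← h2]
    have h4 : π (F - rename f q) ∈ Ideal.span (X '' s : Set (MvPolynomial V k)) := hle h1
    rw [map_sub] at h4
    have := Ideal.sub_mem _ hF h4
    rwa [sub_sub_cancel] at this
  have hq0 : q = 0 := eq_zero_of_rename_mem_span_X_image hv s hs q h3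
  rw [hq0, map_zero, sub_zero] at h1
  exact h1

/-- The contraction through the presented ring: if `π⁻¹ J = span G` in `k[Y]` then along the
injection `k[Y] ⧸ ker π → k[x]` the contraction of `J` is the ideal of the classes of `G`.
[folklore] -/
theorem comap_quotientLift_eq {P B : Type*} [CommRing P] [CommRing B] (π : P →+* B) (J : Ideal B)
    (G : Set P) (hG : Ideal.comap π J = Ideal.span G) :
    Ideal.comap (Ideal.Quotient.lift (RingHom.ker π) π fun _ h => h) J =
      Ideal.span (Ideal.Quotient.mk (RingHom.ker π) '' G) := by
  have hsurj : Function.Surjective (Ideal.Quotient.mk (RingHom.ker π)) := Ideal.Quotient.mk_surjective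
  have h1 : Ideal.comap (Ideal.Quotient.mk (RingHom.ker π))
      (Ideal.comap (Ideal.Quotient.lift (RingHom.ker π) π fun _ h => h) J) = Ideal.span G := by
    rw [Ideal.comap_comap]
    have : (Ideal.Quotient.lift (RingHom.ker π) π fun _ h => h).comp
        (Ideal.Quotient.mk (RingHom.ker π)) = π := by
      ext x; simp
    rw [this, hG]
  have h2 := congrArg (Ideal.map (Ideal.Quotient.mk (RingHom.ker π))) h1
  rwa [Ideal.map_comap_of_surjective _ hsurj, Ideal.map_span] at h2

end ConeVertex

/-! ## The `⅓(1,1,2)` cone -/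

namespace Third112

variable (k : Type) [Field k] (n : ℕ) (a b c : Fin n)

/-- `{X a, X b, X c} = X '' {a, b, c}`. [folklore] -/
theorem X_triple_eq_image :
    ({X a, X b, X c} : Set (MvPolynomial (Fin n) k)) = X '' {a, b, c} := by
  simp [Set.image_insert_eq]

/-- **`presentation⁻¹ (x_a, x_b, x_c) = (generator symbols)`** in `k[Y]` for the `⅓(1,1,2) × 𝔸` cone.
[OURS · L1 W4.5c] [folklore] -/
theorem comap_presentation_span_X (hab : a ≠ b) (hbc : b ≠ c) (hac : a ≠ c) :
    Ideal.comap (presentation k n a b c) (Ideal.span {X a, X b, X c}) =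
      Ideal.span (Set.range (gens k n a b c)) := by
  classical
  rw [X_triple_eq_image, ← X_image_eq_range_gens, ← compl_range_passenger_eq]
  refine ConeVertex.comap_span_X_image_eq (passenger_injective n a b c) (presentation k n a b c)
    (fun i : {i : Fin n // i ≠ a ∧ i ≠ b ∧ i ≠ c} => (i.1 : Fin n))
    (fun i j h => Subtype.ext h) (fun i => presentation_inl_of_ne k n a b c i.1 i.2.1 i.2.2.1 i.2.2.2)
    {a, b, c} ?_ ?_
  · rintro i hi ⟨j, rfl⟩
    simp only [Set.mem_insert_iff, Set.mem_singleton_iff] at hi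
    rcases hi with h | h | h
    exacts [j.2.1 h, j.2.2.1 h, j.2.2.2 h]
  · intro j hj'
    have hj : j ∈ (Set.range (fun i : {i : Fin n // i ≠ a ∧ i ≠ b ∧ i ≠ c} =>
      (Sum.inl i.1 : Fin n ⊕ Fin 4)))ᶜ := hj'
    rw [compl_range_passenger_eq] at hj
    have hXa : (X a : MvPolynomial (Fin n) k) ∈ Ideal.span (X '' {a, b, c}) :=
      Ideal.subset_span ⟨a, by simp, rfl⟩
    have hXb : (X b : MvPolynomial (Fin n) k) ∈ Ideal.span (X '' {a, b, c}) :=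
      Ideal.subset_span ⟨b, by simp, rfl⟩
    have hXc : (X c : MvPolynomial (Fin n) k) ∈ Ideal.span (X '' {a, b, c}) :=
      Ideal.subset_span ⟨c, by simp, rfl⟩
    simp only [Set.mem_insert_iff, Set.mem_singleton_iff] at hj
    rcases hj with rfl | rfl | rfl | rfl | rfl | rfl | rfl
    · rw [presentation_inl_a]; exact Ideal.pow_mem_of_mem _ hXa 3 three_pos
    · rw [presentation_inl_b k n a b c hab]; exact Ideal.pow_mem_of_mem _ hXb 3 three_pos
    · rw [presentation_inl_c k n a b c hac hbc]; exact Ideal.pow_mem_of_mem _ hXc 3 three_pos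
    · rw [presentation_inr_zero]; exact Ideal.mul_mem_left _ _ hXb
    · rw [presentation_inr_one]; exact Ideal.mul_mem_left _ _ (Ideal.pow_mem_of_mem _ hXb 2 two_pos)
    · rw [presentation_inr_two]; exact Ideal.mul_mem_left _ _ hXc
    · rw [presentation_inr_three]; exact Ideal.mul_mem_left _ _ hXc

/-- In particular `ker presentation ≤ (generator symbols)`. [folklore] -/
theorem ker_presentation_le_span_gens (hab : a ≠ b) (hbc : b ≠ c) (hac : a ≠ c) :
    RingHom.ker (presentation k n a b c) ≤ Ideal.span (Set.range (gens k n a b c)) := by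
  rw [← comap_presentation_span_X k n a b c hab hbc hac]
  exact Ideal.comap_mono bot_le

/-- **The vertex ideal is the contraction of `(x_a, x_b, x_c)`** along the injection
`k[Y] ⧸ ker → k[x]` of the presented `⅓(1,1,2) × 𝔸` cone ring (EXACT equality of ideals): the
cone-side half of the centre identification «`Z₀` = vertex `× 𝔸`» of the `μ₃` cone brick `HP₀`.
[OURS · L1 W4.5c] [folklore] -/
theorem comap_lift_span_X (hab : a ≠ b) (hbc : b ≠ c) (hac : a ≠ c) :
    Ideal.comap (Ideal.Quotient.lift (RingHom.ker (presentation k n a b c).toRingHom)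
        (presentation k n a b c).toRingHom fun _ h => h) (Ideal.span {X a, X b, X c}) =
      Ideal.span (Set.range (fun l : Fin 7 =>
        Ideal.Quotient.mk (RingHom.ker (presentation k n a b c)) (gens k n a b c l))) := by
  rw [Set.range_comp' (Ideal.Quotient.mk _) (gens k n a b c)]
  exact ConeVertex.comap_quotientLift_eq (presentation k n a b c).toRingHom _ _
    (comap_presentation_span_X k n a b c hab hbc hac)

end Third112

/-! ## The `½(1,1,1)` cone -/

namespace Half111

variable (k : Type) [Field k] (n : ℕ) (a b c : Fin n)

/-- **`presentation⁻¹ (x_a, x_b, x_c) = (generator symbols)`** in `k[Y]` for the `½(1,1,1) × 𝔸` cone.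
[OURS · L1 W4.5c] [folklore] -/
theorem comap_presentation_span_X (hab : a ≠ b) (hbc : b ≠ c) (hac : a ≠ c) :
    Ideal.comap (presentation k n a b c) (Ideal.span {X a, X b, X c}) =
      Ideal.span (Set.range (gens k n a b c)) := by
  classical
  rw [Third112.X_triple_eq_image, ← X_image_eq_range_gens, ← compl_range_passenger_eq]
  refine ConeVertex.comap_span_X_image_eq (passenger_injective n a b c) (presentation k n a b c)
    (fun i : {i : Fin n // i ≠ a ∧ i ≠ b ∧ i ≠ c} => (i.1 : Fin n))
    (fun i j h => Subtype.ext h) (fun i => presentation_inl_of_ne k n a b c i.1 i.2.1 i.2.2.1 i.2.2.2)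
    {a, b, c} ?_ ?_
  · rintro i hi ⟨j, rfl⟩
    simp only [Set.mem_insert_iff, Set.mem_singleton_iff] at hi
    rcases hi with h | h | h
    exacts [j.2.1 h, j.2.2.1 h, j.2.2.2 h]
  · intro j hj'
    have hj : j ∈ (Set.range (fun i : {i : Fin n // i ≠ a ∧ i ≠ b ∧ i ≠ c} =>
      (Sum.inl i.1 : Fin n ⊕ Fin 3)))ᶜ := hj'
    rw [compl_range_passenger_eq] at hj
    have hXa : (X a : MvPolynomial (Fin n) k) ∈ Ideal.span (X '' {a, b, c}) :=
      Ideal.subset_span ⟨a, by simp, rfl⟩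
    have hXb : (X b : MvPolynomial (Fin n) k) ∈ Ideal.span (X '' {a, b, c}) :=
      Ideal.subset_span ⟨b, by simp, rfl⟩
    have hXc : (X c : MvPolynomial (Fin n) k) ∈ Ideal.span (X '' {a, b, c}) :=
      Ideal.subset_span ⟨c, by simp, rfl⟩
    simp only [Set.mem_insert_iff, Set.mem_singleton_iff] at hj
    rcases hj with rfl | rfl | rfl | rfl | rfl | rfl
    · rw [presentation_inl_a]; exact Ideal.pow_mem_of_mem _ hXa 2 two_pos
    · rw [presentation_inl_b k n a b c hab]; exact Ideal.pow_mem_of_mem _ hXb 2 two_pos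
    · rw [presentation_inl_c k n a b c hac hbc]; exact Ideal.pow_mem_of_mem _ hXc 2 two_pos
    · rw [presentation_inr_zero]; exact Ideal.mul_mem_left _ _ hXb
    · rw [presentation_inr_one]; exact Ideal.mul_mem_left _ _ hXc
    · rw [presentation_inr_two]; exact Ideal.mul_mem_left _ _ hXc

/-- In particular `ker presentation ≤ (generator symbols)`. [folklore] -/
theorem ker_presentation_le_span_gens (hab : a ≠ b) (hbc : b ≠ c) (hac : a ≠ c) :
    RingHom.ker (presentation k n a b c) ≤ Ideal.span (Set.range (gens k n a b c)) := by
  rw [← comap_presentation_span_X k n a b c hab hbc hac]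
  exact Ideal.comap_mono bot_le

/-- **The vertex ideal is the contraction of `(x_a, x_b, x_c)`** along the injection
`k[Y] ⧸ ker → k[x]` of the presented `½(1,1,1) × 𝔸` cone ring (EXACT equality): the cone-side half of
the centre identification «`Z₁` = vertex `× 𝔸`» of the `μ₂` cone brick `HP₁`. [OURS · L1 W4.5c]
[folklore] -/
theorem comap_lift_span_X (hab : a ≠ b) (hbc : b ≠ c) (hac : a ≠ c) :
    Ideal.comap (Ideal.Quotient.lift (RingHom.ker (presentation k n a b c).toRingHom)
        (presentation k n a b c).toRingHom fun _ h => h) (Ideal.span {X a, X b, X c}) =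
      Ideal.span (Set.range (fun l : Fin 6 =>
        Ideal.Quotient.mk (RingHom.ker (presentation k n a b c)) (gens k n a b c l))) := by
  rw [Set.range_comp' (Ideal.Quotient.mk _) (gens k n a b c)]
  exact ConeVertex.comap_quotientLift_eq (presentation k n a b c).toRingHom _ _
    (comap_presentation_span_X k n a b c hab hbc hac)

end Half111

end Summit.ResolutionOfSingularities.ResolutionOfSingularities.Theorems.WildQuotientResolution

end
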